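import Summits.BirchSwinnertonDyer.BirchSwinnertonDyer.Theorems.PrintX8VSCLowerDivisibilityContraOfCruxBodiesAt
import Summits.BirchSwinnertonDyer.BirchSwinnertonDyer.Theorems.PrintX8VSCCruxesOfSharpFlatMainConjectureContra
import HarnessLib

/-!
# Route `PrintX8VSC`: at ONE X8 pair `(E,3)` of analytic rank `≤ 1`, Sprung's Main Conj. 7.21 in print keying ⟺ the bodies of the
# two cruxes K′ (23732) and C′ (23733) AT THAT PAIR — p3's «the exact missing input is the crux», per pair

Cell `bsd-print-x8`, seat p3 (gen 9; «does BSTW 2024 cover `a_p ≠ 0` at `p = 3`? … no ⇒ the exact missing input is the crux»). Sequel of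
`PrintX8VSCLowerDivisibilityContraOfCruxBodiesAt` (§1–§2: K(W,p) ∧ C(W,p) ⟹ MC(W,p) at an X8 pair of analytic rank `≤ 1`). Notation as
there: K(W,p), C(W,p), MC(W,p) = the bodies of the route decls `KatoFineLowerSporadicGivenHeldX8Contra` (23732),
`CyclotomicLowerPosLevelGivenHeldX8Contra` (23733), `SharpFlatMainConjectureX8Contra` (23742) AT ONE PAIR, verbatim after their antecedents.

* §3 `katoFineLowerAt_of_sharpFlatMainConjectureContraAt` (MC(W,p) ⟹ K(W,p), any X8 pair, Sprung Thm. 7.14 displayed for finiteness) and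
  `cyclotomicLowerAt_of_sharpFlatMainConjectureContraAt` (MC(W,p) ⟹ C(W,p), any pair, fact-free) — the per-pair forms of p679782 §3,
  through its pointwise §1 (`katoFineLengthAt_le_of_charIdeal_eq_contra`: the four-term identity of Sprung Prop. 7.19 / Kato §17.13) and
  §2 (`lengthAt_quotient_span_le_of_charIdeal_eq_contra`: `ι` injective);
* §4 `sharpFlatMainConjectureContraAt_iff_cruxBodiesAt`: **MC(W,p) ⟺ K(W,p) ∧ C(W,p) at every X8 pair of analytic rank `≤ 1`**, displaying
  only PRINTED facts {Sprung 2012 Thm. 7.14, Thm. 7.16 (contragredient reading), period unit at 3, the `γ⁻¹`-keyed joint Coleman–Kato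
  package, GZK, Kobayashi 2013 Cor. 1.3 (i)} (THEOREM B in-kernel).

READING (p3's sentence, per pair): BSTW 2024 ((1.7) p. 6, §1.5 p. 11: `a₃ = 0`) does not reach any X8 pair; at each of the 217 census
cells `(E,3)` (X8, `r_an ≤ 1`; ty3 `x8_records.json`, ref R-294) the open content of the route of record is EXACTLY Sprung's Main Conj.
7.21 at `(E,3)` — equivalently exactly K ∧ C at `(E,3)`: the cruxes neither overshoot nor undershoot at a census pair (they overshoot the
route's `closes` only through the X8 pairs of analytic rank `≥ 2`, over which K′/C′ also quantify — see the class-level sequel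
`PrintX8VSCSharpFlatMainConjectureX8ContraIffCruxesR`). HONEST FRAMING: plumbing; both sides are OPEN IN PRINT at `a₃ = ±3`; MC 7.21,
K′, C′, MC′, the X8 leaf and BSD are NOT proved. Referee N-287b honoured. beyond-print theorem: no.

References: [Sprung2012] Thm. 7.14 (p. 1504), Prop. 7.19 and Main Conj. 7.21 (p. 1505); [Kato2004Asterisque] Conj. 12.10 (p. 224), §17.13
(p. 280); [BurungaleSkinnerTianWan2024] (1.7) (p. 6), §1.5 (p. 11), Thm. 10.1; [Sprung2024] Thm. 1.1, Conj. 3.33; [SkinnerUrban2014] §3.1.6.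
-/

set_option linter.dupNamespace false
set_option autoImplicit false

noncomputable section

open scoped Classical NumberField MatrixGroups ModularForm

open NumberField IsDedekindDomain CongruenceSubgroup WeierstrassCurve Field
  Literature.NumberTheory.EllipticCurves Literature.NumberTheory.EllipticCurves.ModularForms
  Literature.NumberTheory.EllipticCurves.ZpExtension Literature.NumberTheory.EllipticCurves.Sprung2017
  Literature.NumberTheory.EllipticCurves.Sprung2012 Literature.NumberTheory.EllipticCurves.Rank1Residual
  Literature.NumberTheory.EllipticCurves.IwasawaAlgebra Literature.NumberTheory.EllipticCurves.Kato2004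
  Literature.NumberTheory.EllipticCurves.Module
  Summit.BirchSwinnertonDyer.BirchSwinnertonDyer.Theorems
  Summit.BirchSwinnertonDyer.BirchSwinnertonDyer.Theorems.SmallImageSignedMuDefect
  Summit.BirchSwinnertonDyer.Rank1Residual.Supersingular

namespace Summit.BirchSwinnertonDyer.BirchSwinnertonDyer.Theorems.X8CruxBodiesAtPair

/-! ### §3 MC(W,p) ⟹ K(W,p) and MC(W,p) ⟹ C(W,p) at ANY X8 pair (no rank hypothesis) -/

/-- **MC(W,p) ⟹ K(W,p).** At an X8 pair, Sprung's Main Conj. 7.21 in print keying at the pair (every colour with `L^• ≠ 0`, every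
`γ⁻¹`-keyed datum) gives the body of K′ at the pair — indeed at every height-one `𝔭`, the sporadic / common-zero side conditions unused:
on X8 some colour `•₀` has `L^•₀ ≠ 0` (`ClassX8.exists_chromaticL_ne_zero`), a `γ⁻¹`-keyed datum of that colour exists and is finitely
generated (Thm. 7.14 through the keying dictionary), MC(W,p) pins its characteristic ideal, and p679782 §1
(`katoFineLengthAt_le_of_charIdeal_eq_contra`) at the package of colour `•₀` (`Cs.Z = Cf.Z`). Per-pair form of
`katoFineLowerSporadicGivenHeldX8Contra_of_mainConjecture721Contra`. CONDITIONAL; closes nothing.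
[cite: Sprung2012, Thm. 7.14 (3) (p. 1504), Prop. 7.19 and Main Conj. 7.21 (p. 1505)] [cite: Kato2004Asterisque, Conj. 12.10 (p. 224)] -/
theorem katoFineLowerAt_of_sharpFlatMainConjectureContraAt (h714 : thm714_sharpFlatSelmerDual_finite_torsion)
    (W : WeierstrassCurve ℚ) [W.IsElliptic] [W.IsGloballyMinimal] (p : ℕ) [Fact p.Prime]
    [ContinuousSMul ℤ_[p] (W.tateModule p)] [Module.Free ℤ_[p] (W.tateModule p)]
    [Module.Finite ℤ_[p] (W.tateModule p)] (hX : ClassX8 W p)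
    (hMCW :
      ∀ (col : Chroma) (κ : ZpExtension ℚ p) (γ : Field.absoluteGaloisGroup ℚ),
        κ.IsCyclotomic → κ.IsTopGenerator γ → IsCyclotomicVariable p γ →
        ∀ (v : HeightOneSpectrum (𝓞 ℚ)), (p : 𝓞 ℚ) ∈ v.asIdeal →
        ∀ (g : Field.absoluteGaloisGroup (v.adicCompletion ℚ)),
          κ.IsTopGenerator (resGalOfEmb (closureEmb (K := ℚ) (v.adicCompletion ℚ)) g) →
        ∀ (cneg : localPoints W (v.adicCompletion ℚ)) (c : ℕ → localPoints W (v.adicCompletion ℚ)),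
          IsHondaSystem κ (closureEmb (K := ℚ) (v.adicCompletion ℚ)) W (W.frobeniusTrace p) g cneg c →
        ∀ (N : ℕ) (_ : NeZero N) (f : CuspForm (Gamma0 N) 2) (ϖ : ℚ) (Lsharp Lflat : IwasawaAlgebra p),
          IsNewformOf W f → (ϖ : ℝ) * W.realPeriodRat = plusPeriod f →
          IsSprungPair f p (W.frobeniusTrace p) Lsharp Lflat → chromaticL col Lsharp Lflat ≠ 0 →
        ∀ (D : SharpFlatSelmerDualData W κ γ⁻¹ (closureEmb (K := ℚ) (v.adicCompletion ℚ))
            (W.frobeniusTrace p) g c col),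
          Module.IsTorsion (IwasawaAlgebra p) D.X ∧
          ∃ gen : IwasawaAlgebra p, D.charIdeal = Ideal.span {gen} ∧
            iwasawaToPowerSeries p gen =
              PowerSeries.C (ϖ : ℚ_[p]) * iwasawaToPowerSeries p (chromaticL col Lsharp Lflat)) :
    ∀ (κ : ZpExtension ℚ p) (γ : Field.absoluteGaloisGroup ℚ),
      κ.IsCyclotomic → κ.IsTopGenerator γ → IsCyclotomicVariable p γ →
    ∀ (v : HeightOneSpectrum (𝓞 ℚ)), (p : 𝓞 ℚ) ∈ v.asIdeal →
    ∀ (g : Field.absoluteGaloisGroup (v.adicCompletion ℚ)),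
      κ.IsTopGenerator (resGalOfEmb (closureEmb (K := ℚ) (v.adicCompletion ℚ)) g) →
    ∀ (cneg : localPoints W (v.adicCompletion ℚ)) (c : ℕ → localPoints W (v.adicCompletion ℚ)),
      IsHondaSystem κ (closureEmb (K := ℚ) (v.adicCompletion ℚ)) W (W.frobeniusTrace p) g cneg c →
    ∀ (N : ℕ) (_ : NeZero N) (f : CuspForm (Gamma0 N) 2) (ϖ : ℚ) (Lsharp Lflat : IwasawaAlgebra p),
      IsNewformOf W f → (ϖ : ℝ) * W.realPeriodRat = plusPeriod f →
      IsSprungPair f p (W.frobeniusTrace p) Lsharp Lflat →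
    ∀ (I : Kato2004.IwasawaH1Data W p κ γ)
      (Cs : SharpFlatColemanKatoDataContra W p f ϖ κ γ (closureEmb (K := ℚ) (v.adicCompletion ℚ))
        (W.frobeniusTrace p) g c Chroma.sharp I)
      (Cf : SharpFlatColemanKatoDataContra W p f ϖ κ γ (closureEmb (K := ℚ) (v.adicCompletion ℚ))
        (W.frobeniusTrace p) g c Chroma.flat I),
      Cs.Z = Cf.Z →
    ∀ (Y : W.FineSelmerDualData κ γ⁻¹) (𝔭 : PrimeSpectrum (IwasawaAlgebra p)), 𝔭.asIdeal.height = 1 →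
      (p : IwasawaAlgebra p) ∉ 𝔭.asIdeal →
      (¬ ∃ n : ℕ, ((cyclotomicOmega p n).map (Int.castRingHom ℤ_[p]) : PowerSeries ℤ_[p]) ∈ 𝔭.asIdeal) →
      (∀ (col' : Chroma) (G' : IwasawaAlgebra p),
        iwasawaToPowerSeries p G' =
          PowerSeries.C (ϖ : ℚ_[p]) * iwasawaToPowerSeries p (chromaticL col' Lsharp Lflat) →
        G' ∈ 𝔭.asIdeal) →
      Module.lengthAt (IwasawaAlgebra p) (I.H ⧸ Cs.Z) 𝔭 ≤ Module.lengthAt (IwasawaAlgebra p) Y.X 𝔭 := by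
  intro κ γ hκ hγ hcv v hv g hg cneg c hH N hN f ϖ Lsharp Lflat hf hϖ hSP I Cs Cf hZ Y 𝔭 h𝔭 _hp𝔭 _hspor _hcommon
  haveI : NeZero N := hN
  obtain ⟨hp3, ⟨hgood, hap⟩, -⟩ := id hX
  subst hp3
  have hirr : W.HasIrreducibleModPGaloisRep 3 := ClassX8.irr' W 3 hX
  obtain ⟨col₀, hcol₀⟩ := Rank1Residual.Supersingular.ClassX8.exists_chromaticL_ne_zero W 3 hX hf hSP
  -- a γ⁻¹-keyed (print) dual datum of the non-zero colour, finitely generated by Thm 7.14 through the dictionary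
  obtain ⟨D'⟩ := nonempty_sharpFlatSelmerDualData_rat W κ γ⁻¹ v g c col₀
  obtain ⟨D₀⟩ := nonempty_sharpFlatSelmerDualData_rat W κ γ v g c col₀
  obtain ⟨hfin₀, -⟩ :=
    h714 W 3 (by decide) hgood hap f hf κ γ hκ hγ hcv v hv g hg cneg c hH col₀ Lsharp Lflat hSP hcol₀ D₀
  haveI := hfin₀
  haveI : Module.Finite (IwasawaAlgebra 3) D'.X := (sharpFlatSelmerDualData_finite_inv_iff D₀ D').1 hfin₀
  -- Main Conj. 7.21 (print key) AT THE PAIR for that datum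
  obtain ⟨hDt, gen, hchar, hgen⟩ := hMCW col₀ κ γ hκ hγ hcv v hv g hg cneg c hH N hN f ϖ Lsharp Lflat hf hϖ hSP hcol₀ D'
  cases col₀ with
  | sharp =>
    exact PrintX8VSCOfMainConjecture721.katoFineLengthAt_le_of_charIdeal_eq_contra W 3 Cs hirr hSP hcol₀ D' hDt hchar hgen
      Y 𝔭 h𝔭
  | flat =>
    rw [hZ]
    exact PrintX8VSCOfMainConjecture721.katoFineLengthAt_le_of_charIdeal_eq_contra W 3 Cf hirr hSP hcol₀ D' hDt hchar hgen
      Y 𝔭 h𝔭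

/-- **MC(W,p) ⟹ C(W,p).** At any pair, Sprung's Main Conj. 7.21 in print keying at the pair gives the body of C′ at the pair — at EVERY
height-one `𝔭`, the cyclotomic / common-zero side conditions unused: MC(W,p) at the crux's own datum `D` gives `char D.X = (gen)`,
`gen = G` by injectivity of `ι`, and p679782 §2 (`lengthAt_quotient_span_le_of_charIdeal_eq_contra`). Per-pair form of
`cyclotomicLowerPosLevelGivenHeldX8Contra_of_mainConjecture721Contra`; not even `ClassX8` is used. CONDITIONAL; closes nothing.
[cite: Sprung2012, Prop. 7.19 and Main Conj. 7.21 (p. 1505)] -/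
theorem cyclotomicLowerAt_of_sharpFlatMainConjectureContraAt
    (W : WeierstrassCurve ℚ) [W.IsElliptic] [W.IsGloballyMinimal] (p : ℕ) [Fact p.Prime]
    [ContinuousSMul ℤ_[p] (W.tateModule p)] [Module.Free ℤ_[p] (W.tateModule p)]
    [Module.Finite ℤ_[p] (W.tateModule p)]
    (hMCW :
      ∀ (col : Chroma) (κ : ZpExtension ℚ p) (γ : Field.absoluteGaloisGroup ℚ),
        κ.IsCyclotomic → κ.IsTopGenerator γ → IsCyclotomicVariable p γ →
        ∀ (v : HeightOneSpectrum (𝓞 ℚ)), (p : 𝓞 ℚ) ∈ v.asIdeal →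
        ∀ (g : Field.absoluteGaloisGroup (v.adicCompletion ℚ)),
          κ.IsTopGenerator (resGalOfEmb (closureEmb (K := ℚ) (v.adicCompletion ℚ)) g) →
        ∀ (cneg : localPoints W (v.adicCompletion ℚ)) (c : ℕ → localPoints W (v.adicCompletion ℚ)),
          IsHondaSystem κ (closureEmb (K := ℚ) (v.adicCompletion ℚ)) W (W.frobeniusTrace p) g cneg c →
        ∀ (N : ℕ) (_ : NeZero N) (f : CuspForm (Gamma0 N) 2) (ϖ : ℚ) (Lsharp Lflat : IwasawaAlgebra p),
          IsNewformOf W f → (ϖ : ℝ) * W.realPeriodRat = plusPeriod f →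
          IsSprungPair f p (W.frobeniusTrace p) Lsharp Lflat → chromaticL col Lsharp Lflat ≠ 0 →
        ∀ (D : SharpFlatSelmerDualData W κ γ⁻¹ (closureEmb (K := ℚ) (v.adicCompletion ℚ))
            (W.frobeniusTrace p) g c col),
          Module.IsTorsion (IwasawaAlgebra p) D.X ∧
          ∃ gen : IwasawaAlgebra p, D.charIdeal = Ideal.span {gen} ∧
            iwasawaToPowerSeries p gen =
              PowerSeries.C (ϖ : ℚ_[p]) * iwasawaToPowerSeries p (chromaticL col Lsharp Lflat)) :
    ∀ (col : Chroma) (κ : ZpExtension ℚ p) (γ : Field.absoluteGaloisGroup ℚ),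
      κ.IsCyclotomic → κ.IsTopGenerator γ → IsCyclotomicVariable p γ →
    ∀ (v : HeightOneSpectrum (𝓞 ℚ)), (p : 𝓞 ℚ) ∈ v.asIdeal →
    ∀ (g : Field.absoluteGaloisGroup (v.adicCompletion ℚ)),
      κ.IsTopGenerator (resGalOfEmb (closureEmb (K := ℚ) (v.adicCompletion ℚ)) g) →
    ∀ (cneg : localPoints W (v.adicCompletion ℚ)) (c : ℕ → localPoints W (v.adicCompletion ℚ)),
      IsHondaSystem κ (closureEmb (K := ℚ) (v.adicCompletion ℚ)) W (W.frobeniusTrace p) g cneg c →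
    ∀ (N : ℕ) (_ : NeZero N) (f : CuspForm (Gamma0 N) 2) (ϖ : ℚ) (Lsharp Lflat : IwasawaAlgebra p),
      IsNewformOf W f → (ϖ : ℝ) * W.realPeriodRat = plusPeriod f →
      IsSprungPair f p (W.frobeniusTrace p) Lsharp Lflat → chromaticL col Lsharp Lflat ≠ 0 →
    ∀ (D : SharpFlatSelmerDualData W κ γ⁻¹ (closureEmb (K := ℚ) (v.adicCompletion ℚ))
        (W.frobeniusTrace p) g c col) [Module.Finite (IwasawaAlgebra p) D.X],
      Module.IsTorsion (IwasawaAlgebra p) D.X →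
    ∀ (G : IwasawaAlgebra p),
      iwasawaToPowerSeries p G =
        PowerSeries.C (ϖ : ℚ_[p]) * iwasawaToPowerSeries p (chromaticL col Lsharp Lflat) →
    ∀ (I : Kato2004.IwasawaH1Data W p κ γ)
      (Cs : SharpFlatColemanKatoDataContra W p f ϖ κ γ (closureEmb (K := ℚ) (v.adicCompletion ℚ))
        (W.frobeniusTrace p) g c Chroma.sharp I)
      (Cf : SharpFlatColemanKatoDataContra W p f ϖ κ γ (closureEmb (K := ℚ) (v.adicCompletion ℚ))
        (W.frobeniusTrace p) g c Chroma.flat I),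
      Cs.Z = Cf.Z →
    ∀ 𝔭 : PrimeSpectrum (IwasawaAlgebra p), 𝔭.asIdeal.height = 1 →
      (PowerSeries.X : IwasawaAlgebra p) ∉ 𝔭.asIdeal →
      (∃ j : ℕ, 1 ≤ j ∧
        ((((Polynomial.cyclotomic (p ^ j) ℤ).comp (Polynomial.X + 1)).map (Int.castRingHom ℤ_[p]) : Polynomial ℤ_[p]) :
          PowerSeries ℤ_[p]) ∈ 𝔭.asIdeal) →
      (∀ (col' : Chroma) (G' : IwasawaAlgebra p),
        iwasawaToPowerSeries p G' =
          PowerSeries.C (ϖ : ℚ_[p]) * iwasawaToPowerSeries p (chromaticL col' Lsharp Lflat) →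
        G' ∈ 𝔭.asIdeal) →
      Module.lengthAt (IwasawaAlgebra p) (IwasawaAlgebra p ⧸ Ideal.span {G}) 𝔭 ≤
        Module.lengthAt (IwasawaAlgebra p) D.X 𝔭 := by
  intro col κ γ hκ hγ hcv v hv g hg cneg c hH N hN f ϖ Lsharp Lflat hf hϖ hSP hcol D hDfin hDt G hG _I _Cs _Cf _hZ 𝔭 h𝔭 _hT
    _hcyc _hcommon
  haveI := hDfin
  obtain ⟨-, gen, hchar, hgen⟩ := hMCW col κ γ hκ hγ hcv v hv g hg cneg c hH N hN f ϖ Lsharp Lflat hf hϖ hSP hcol D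
  exact PrintX8VSCOfMainConjecture721.lengthAt_quotient_span_le_of_charIdeal_eq_contra hDt hchar hgen hG 𝔭 h𝔭

/-! ### §4 The per-pair equivalence -/

/-- **MC(W,p) ⟺ K(W,p) ∧ C(W,p) at every X8 pair of analytic rank `≤ 1`** (all 217 census cells `(E,3)`, `a₃ = ±3`, `r_an ≤ 1`):
displaying the printed facts `h714`, `h716c`, `h3`, `hJc`, `hGZK`, `hKob` (THEOREM B in-kernel), Sprung's Main Conj. 7.21 in print keying
AT THE PAIR is EQUIVALENT to the conjunction of the bodies of the route's two research cruxes K′ (23732) and C′ (23733) AT THE PAIR.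
p3's sentence per pair: BSTW 2024 ((1.7): `a₃ = 0`) does not reach `(E,3)`, and what is missing there is exactly Main Conj. 7.21 at
`(E,3)` = exactly K ∧ C at `(E,3)`. ⟹: §3; ⟸: `ChromaticCommonZeros.sharpFlatMainConjectureContraAt_of_cruxBodiesAt`. Both sides OPEN IN
PRINT at `a₃ = ±3`; nothing is asserted. [cite: Sprung2012, Prop. 7.19 and Main Conj. 7.21 (p. 1505)]
[cite: Kato2004Asterisque, Conj. 12.10 (p. 224)] [cite: BurungaleSkinnerTianWan2024, (1.7) (p. 6) and §1.5 (p. 11)] -/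
theorem sharpFlatMainConjectureContraAt_iff_cruxBodiesAt
    (h714 : thm714_sharpFlatSelmerDual_finite_torsion) (h716c : thm716_sharpFlatCharIdeal_divisibility_contra)
    (h3 : realPeriodRat_eq_unit_mul_plusPeriod_three) (hJc : thm714seq_sharpFlatColemanKato_zetaJoint_contra)
    (hGZK : rank_eq_analyticRank_of_analyticRank_le_one) (hKob : Kobayashi2013.cor13i_sharpFlat_minOrder_eq_one)
    (W : WeierstrassCurve ℚ) [W.IsElliptic] [W.IsGloballyMinimal] (p : ℕ) [Fact p.Prime]
    [ContinuousSMul ℤ_[p] (W.tateModule p)] [Module.Free ℤ_[p] (W.tateModule p)]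
    [Module.Finite ℤ_[p] (W.tateModule p)] (hX : ClassX8 W p) (hr : W.analyticRank ≤ 1) :
    (∀ (col : Chroma) (κ : ZpExtension ℚ p) (γ : Field.absoluteGaloisGroup ℚ),
        κ.IsCyclotomic → κ.IsTopGenerator γ → IsCyclotomicVariable p γ →
        ∀ (v : HeightOneSpectrum (𝓞 ℚ)), (p : 𝓞 ℚ) ∈ v.asIdeal →
        ∀ (g : Field.absoluteGaloisGroup (v.adicCompletion ℚ)),
          κ.IsTopGenerator (resGalOfEmb (closureEmb (K := ℚ) (v.adicCompletion ℚ)) g) →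
        ∀ (cneg : localPoints W (v.adicCompletion ℚ)) (c : ℕ → localPoints W (v.adicCompletion ℚ)),
          IsHondaSystem κ (closureEmb (K := ℚ) (v.adicCompletion ℚ)) W (W.frobeniusTrace p) g cneg c →
        ∀ (N : ℕ) (_ : NeZero N) (f : CuspForm (Gamma0 N) 2) (ϖ : ℚ) (Lsharp Lflat : IwasawaAlgebra p),
          IsNewformOf W f → (ϖ : ℝ) * W.realPeriodRat = plusPeriod f →
          IsSprungPair f p (W.frobeniusTrace p) Lsharp Lflat → chromaticL col Lsharp Lflat ≠ 0 →
        ∀ (D : SharpFlatSelmerDualData W κ γ⁻¹ (closureEmb (K := ℚ) (v.adicCompletion ℚ))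
            (W.frobeniusTrace p) g c col),
          Module.IsTorsion (IwasawaAlgebra p) D.X ∧
          ∃ gen : IwasawaAlgebra p, D.charIdeal = Ideal.span {gen} ∧
            iwasawaToPowerSeries p gen =
              PowerSeries.C (ϖ : ℚ_[p]) * iwasawaToPowerSeries p (chromaticL col Lsharp Lflat)) ↔
    (∀ (κ : ZpExtension ℚ p) (γ : Field.absoluteGaloisGroup ℚ),
        κ.IsCyclotomic → κ.IsTopGenerator γ → IsCyclotomicVariable p γ →
      ∀ (v : HeightOneSpectrum (𝓞 ℚ)), (p : 𝓞 ℚ) ∈ v.asIdeal →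
      ∀ (g : Field.absoluteGaloisGroup (v.adicCompletion ℚ)),
        κ.IsTopGenerator (resGalOfEmb (closureEmb (K := ℚ) (v.adicCompletion ℚ)) g) →
      ∀ (cneg : localPoints W (v.adicCompletion ℚ)) (c : ℕ → localPoints W (v.adicCompletion ℚ)),
        IsHondaSystem κ (closureEmb (K := ℚ) (v.adicCompletion ℚ)) W (W.frobeniusTrace p) g cneg c →
      ∀ (N : ℕ) (_ : NeZero N) (f : CuspForm (Gamma0 N) 2) (ϖ : ℚ) (Lsharp Lflat : IwasawaAlgebra p),
        IsNewformOf W f → (ϖ : ℝ) * W.realPeriodRat = plusPeriod f →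
        IsSprungPair f p (W.frobeniusTrace p) Lsharp Lflat →
      ∀ (I : Kato2004.IwasawaH1Data W p κ γ)
        (Cs : SharpFlatColemanKatoDataContra W p f ϖ κ γ (closureEmb (K := ℚ) (v.adicCompletion ℚ))
          (W.frobeniusTrace p) g c Chroma.sharp I)
        (Cf : SharpFlatColemanKatoDataContra W p f ϖ κ γ (closureEmb (K := ℚ) (v.adicCompletion ℚ))
          (W.frobeniusTrace p) g c Chroma.flat I),
        Cs.Z = Cf.Z →
      ∀ (Y : W.FineSelmerDualData κ γ⁻¹) (𝔭 : PrimeSpectrum (IwasawaAlgebra p)), 𝔭.asIdeal.height = 1 →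
        (p : IwasawaAlgebra p) ∉ 𝔭.asIdeal →
        (¬ ∃ n : ℕ, ((cyclotomicOmega p n).map (Int.castRingHom ℤ_[p]) : PowerSeries ℤ_[p]) ∈ 𝔭.asIdeal) →
        (∀ (col' : Chroma) (G' : IwasawaAlgebra p),
          iwasawaToPowerSeries p G' =
            PowerSeries.C (ϖ : ℚ_[p]) * iwasawaToPowerSeries p (chromaticL col' Lsharp Lflat) →
          G' ∈ 𝔭.asIdeal) →
        Module.lengthAt (IwasawaAlgebra p) (I.H ⧸ Cs.Z) 𝔭 ≤ Module.lengthAt (IwasawaAlgebra p) Y.X 𝔭) ∧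
    (∀ (col : Chroma) (κ : ZpExtension ℚ p) (γ : Field.absoluteGaloisGroup ℚ),
        κ.IsCyclotomic → κ.IsTopGenerator γ → IsCyclotomicVariable p γ →
      ∀ (v : HeightOneSpectrum (𝓞 ℚ)), (p : 𝓞 ℚ) ∈ v.asIdeal →
      ∀ (g : Field.absoluteGaloisGroup (v.adicCompletion ℚ)),
        κ.IsTopGenerator (resGalOfEmb (closureEmb (K := ℚ) (v.adicCompletion ℚ)) g) →
      ∀ (cneg : localPoints W (v.adicCompletion ℚ)) (c : ℕ → localPoints W (v.adicCompletion ℚ)),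
        IsHondaSystem κ (closureEmb (K := ℚ) (v.adicCompletion ℚ)) W (W.frobeniusTrace p) g cneg c →
      ∀ (N : ℕ) (_ : NeZero N) (f : CuspForm (Gamma0 N) 2) (ϖ : ℚ) (Lsharp Lflat : IwasawaAlgebra p),
        IsNewformOf W f → (ϖ : ℝ) * W.realPeriodRat = plusPeriod f →
        IsSprungPair f p (W.frobeniusTrace p) Lsharp Lflat → chromaticL col Lsharp Lflat ≠ 0 →
      ∀ (D : SharpFlatSelmerDualData W κ γ⁻¹ (closureEmb (K := ℚ) (v.adicCompletion ℚ))
          (W.frobeniusTrace p) g c col) [Module.Finite (IwasawaAlgebra p) D.X],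
        Module.IsTorsion (IwasawaAlgebra p) D.X →
      ∀ (G : IwasawaAlgebra p),
        iwasawaToPowerSeries p G =
          PowerSeries.C (ϖ : ℚ_[p]) * iwasawaToPowerSeries p (chromaticL col Lsharp Lflat) →
      ∀ (I : Kato2004.IwasawaH1Data W p κ γ)
        (Cs : SharpFlatColemanKatoDataContra W p f ϖ κ γ (closureEmb (K := ℚ) (v.adicCompletion ℚ))
          (W.frobeniusTrace p) g c Chroma.sharp I)
        (Cf : SharpFlatColemanKatoDataContra W p f ϖ κ γ (closureEmb (K := ℚ) (v.adicCompletion ℚ))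
          (W.frobeniusTrace p) g c Chroma.flat I),
        Cs.Z = Cf.Z →
      ∀ 𝔭 : PrimeSpectrum (IwasawaAlgebra p), 𝔭.asIdeal.height = 1 →
        (PowerSeries.X : IwasawaAlgebra p) ∉ 𝔭.asIdeal →
        (∃ j : ℕ, 1 ≤ j ∧
          ((((Polynomial.cyclotomic (p ^ j) ℤ).comp (Polynomial.X + 1)).map (Int.castRingHom ℤ_[p]) : Polynomial ℤ_[p]) :
            PowerSeries ℤ_[p]) ∈ 𝔭.asIdeal) →
        (∀ (col' : Chroma) (G' : IwasawaAlgebra p),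
          iwasawaToPowerSeries p G' =
            PowerSeries.C (ϖ : ℚ_[p]) * iwasawaToPowerSeries p (chromaticL col' Lsharp Lflat) →
          G' ∈ 𝔭.asIdeal) →
        Module.lengthAt (IwasawaAlgebra p) (IwasawaAlgebra p ⧸ Ideal.span {G}) 𝔭 ≤
          Module.lengthAt (IwasawaAlgebra p) D.X 𝔭) :=
  ⟨fun hMCW => ⟨katoFineLowerAt_of_sharpFlatMainConjectureContraAt h714 W p hX hMCW,
    cyclotomicLowerAt_of_sharpFlatMainConjectureContraAt W p hMCW⟩,
   fun h => ChromaticCommonZeros.sharpFlatMainConjectureContraAt_of_cruxBodiesAt h714 h716c h3 hJc hGZK hKob W p hX hr h.1 h.2⟩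

end Summit.BirchSwinnertonDyer.BirchSwinnertonDyer.Theorems.X8CruxBodiesAtPair

end
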